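/-
Copyright (c) 2026. All rights reserved.
Released under Apache 2.0 license as described in the file LICENSE.
Authors: abc-iut cell, prover seat abc-iut-L4-t15 (wave 2).
-/
import Literature.AnabelianGeometry.AbsoluteAnabelian.DiagramCores
import Literature.AnabelianGeometry.AbsoluteAnabelian.DiagramTelecorePaths

/-!
# Telecore families from structure functors ([AbsTopIII] Def. 3.5 (iv), toolkit)

S. Mochizuki, *Topics in Absolute Anabelian Geometry III*, Def. 3.5 (iv) p. 76 (manuscript
`paper:url-5493eb38cbb7`, bib key `MochizukiAbsTopIII2015`): a **telecore** `𝒯` over a core `𝒮` (core vertex `v_𝒮`)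
appends telecore edges running OUT of `v_𝒮` and carries a family of homotopies `𝒥` "whose boundary set is equal to the
subset of pairs `([γ₃]∘[γ₁], [γ₃]∘[γ₂])` where `([γ₁],[γ₂])` is a co-verticial pair of paths on `Γ⃗_𝒯` with terminal
vertex `v_𝒮` and `[γ₃]` is a path on `Γ⃗_𝒯` with initial vertex `v_𝒮`".

This file CONSTRUCTS `𝒥` over abc-iut-L4-t2's Def 3.5 formalism (`DiagramsOfCategories.lean`) and abc-iut-L4-t12's
structure-functor toolkit (`DiagramCores.lean`), WITHOUT any full faithfulness (contrast the uniqueness method of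
`DiagramLifts.lean` / `PseudoShadows.lean`): if every category of a diagram `𝒯` with a vertex `ω = v_𝒮` (the telecore
diagram INCLUDING the edges out of `ω`) carries a structure functor over `𝒯_ω` and every functor of `𝒯` lies over `𝒯_ω`
up to a given isomorphism (`OverData`, `N_ω ≅ 𝟭`), then: `obsIsoAt`/`obsIso` are the canonical isomorphisms
`φ_γ : 𝒯_[γ] ≅ N_a` (`γ : a ⟶ ω`; the core homotopy of `DiagramCores` is `φ_{γ₁} ∘ φ_{γ₂}⁻¹`), `loopAt` the LOOP ISOMORPHISM
`σ_m : 𝒯_[m] ≅ 𝟭` of a loop at `ω`; the **loop lemma** `obsIsoAt_hom_inv_loop` (prolonging `γ₁, γ₂` by the same loop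
whiskers the core homotopy with `𝒯_[m]`, by naturality of `σ_m`) and the prefix lemma make the homotopy
`teleHomOfSplit = (φ_{γ₁} ∘ φ_{γ₂}⁻¹) ▷ 𝒯_[γ₃]` of a DECOMPOSED pair independent of the decomposition
(`teleHom_eq_of_split`), reflexive, transitive and compatible with whiskering; `teleFamily` is **the telecore family
`𝒥`** on an extended graph `D.extend Y` (boundary set = the printed one, `DiagramTelecorePaths.TeleRel`; the three axioms
of Def 3.5 (ii) proved).  Used for rows 3–4 of the diagram `D•` of [AbsTopIII] Cor 5.5 (ii), whose structure functors are
not faithful.  All statements are componentwise with PLAIN objects (no `(F ⋙ G).obj`, no `(𝟭 _).obj` in the types),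
which keeps the `eqToHom` bookkeeping of `pathFunctor` (well-founded recursion) tractable.  Elementary category theory;
plumbing `def`s are `[folklore]`, the statements cite the item of Def. 3.5 whose bookkeeping they are.  Nothing here
bears on [IUTchIII] Cor. 3.12.
-/

set_option autoImplicit false

namespace Literature.AnabelianGeometry.AbsoluteAnabelian

open _root_.CategoryTheory _root_.Quiver

universe v u w

/-! ## Structure functors: the canonical isomorphisms `𝒯_[γ] ≅ N_a` and the loop lemma -/

namespace DiagramOfCategories

namespace OverData

variable {W : Type w} [Quiver.{v} W] {S : DiagramOfCategories.{v, u, w} W} {C : Type u} [Category.{v} C]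
  (O : S.OverData C)

/-- Components of `pathIso` on the empty path (from the definition; cf. `DiagramCores.lean`). [cite: MochizukiAbsTopIII2015, Definition 3.5 (iv) p.76] -/
theorem pathIso_nil_hom_app' (a : W) (x : S.obj a) :
    (O.pathIso (Path.nil : Path a a)).hom.app x = eqToHom (by rw [pathFunctor_nil]; rfl) := by
  rw [pathIso]
  simp only [eqToIso.hom, eqToHom_app]

/-- Components of `pathIso` on an extended path (from the definition). [cite: MochizukiAbsTopIII2015, Definition 3.5 (iv) p.76] -/
theorem pathIso_cons_hom_app' {a b c : W} (p : Path a b) (e : b ⟶ c) (x : S.obj a) :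
    (O.pathIso (p.cons e)).hom.app x =
      eqToHom (by rw [pathFunctor_cons]; rfl) ≫ (O.μ e).hom.app ((S.pathFunctor p).obj x) ≫
        (O.pathIso p).hom.app x := by
  rw [pathIso]
  simp only [Iso.trans_hom, eqToIso.hom, NatTrans.comp_app, eqToHom_app, Functor.isoWhiskerLeft_hom,
    Functor.whiskerLeft_app]
  rfl

/-- Transport of a component along an equality of objects. [cite: MochizukiAbsTopIII2015, Definition 3.5 (iv) p.76] -/
theorem app_congr_obj {A B : Type*} [Category A] [Category B] {F G : A ⥤ B} (α : F ⟶ G) {y y' : A}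
    (hy : y = y') : α.app y = eqToHom (by rw [hy]) ≫ α.app y' ≫ eqToHom (by rw [hy]) := by
  subst hy
  simp

/-- `pathIso` along a composite path, componentwise (from the definition; cf. `DiagramCores.lean`):
`pathIso (p ∘ r) = pathIso r ∘ (r ◁ pathIso p)` up to `eqToHom`. [cite: MochizukiAbsTopIII2015, Definition 3.5 (iv) p.76] -/
theorem pathIso_comp_hom_app' {a b c : W} (r : Path a b) (p : Path b c) (x : S.obj a) :
    (O.pathIso (r.comp p)).hom.app x =
      eqToHom (by rw [pathFunctor_comp]; rfl) ≫ (O.pathIso p).hom.app ((S.pathFunctor r).obj x) ≫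
        (O.pathIso r).hom.app x := by
  induction p with
  | nil =>
    simp only [Path.comp_nil, pathIso_nil_hom_app', eqToHom_trans_assoc]
    erw [eqToHom_refl, Category.id_comp]
  | cons p e ih =>
    simp only [Path.comp_cons, pathIso_cons_hom_app', ih, Category.assoc]
    rw [app_congr_obj (O.μ e).hom
      (show (S.pathFunctor (r.comp p)).obj x = (S.pathFunctor p).obj ((S.pathFunctor r).obj x) by
        rw [pathFunctor_comp]; rfl)]
    simp only [Category.assoc, eqToHom_trans_assoc]
    congr 2
    erw [eqToHom_trans_assoc, eqToHom_refl, Category.id_comp]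
    rfl

end OverData

/-- Components of the shape of `HomotopyFamily.η_whisker`, with plain objects. [cite: MochizukiAbsTopIII2015, Definition 3.5 (ii) p.75] -/
theorem app_eqToHom_whisker {A B C E : Type*} [Category A] [Category B] [Category C] [Category E] {F : A ⥤ B}
    {K K' : B ⥤ C} {G : C ⥤ E} (α : K ⟶ K') {P Q : A ⥤ E} (h₁ : P = F ⋙ K ⋙ G) (h₂ : F ⋙ K' ⋙ G = Q) (x : A) :
    (eqToHom h₁ ≫ Functor.whiskerLeft F (Functor.whiskerRight α G) ≫ eqToHom h₂).app x =
      eqToHom (by rw [h₁]; rfl) ≫ G.map (α.app (F.obj x)) ≫ eqToHom (by rw [← h₂]; rfl) := by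
  subst h₁ h₂
  simp only [eqToHom_refl, Category.id_comp, Category.comp_id, Functor.whiskerLeft_app, Functor.whiskerRight_app]
  symm
  erw [eqToHom_refl, eqToHom_refl, Category.id_comp, Category.comp_id]

section ObsIso

variable {W : Type w} [Quiver.{v} W] (S : DiagramOfCategories.{v, u, w} W) (ω : W)
  (O : S.OverData (S.obj ω)) (ε : O.N ω ≅ 𝟭 (S.obj ω))

/-- `N_{v_𝒮} ≅ 𝟭` at an object (stated with plain objects, so that compositions below carry no `(𝟭 _).obj`). [folklore] -/
noncomputable def εAt (y : S.obj ω) : (O.N ω).obj y ≅ y := ε.app y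

/-- Naturality of `ε` at objects. [cite: MochizukiAbsTopIII2015, Definition 3.5 (iv) p.76] -/
theorem map_εAt_hom {y y' : S.obj ω} (f : y ⟶ y') :
    (O.N ω).map f ≫ (εAt S ω O ε y').hom = (εAt S ω O ε y).hom ≫ f := by
  simpa [εAt] using ε.hom.naturality f

/-- Naturality of `ε⁻¹` at objects. [cite: MochizukiAbsTopIII2015, Definition 3.5 (iv) p.76] -/
theorem map_εAt_inv {y y' : S.obj ω} (g : y ⟶ y') :
    g ≫ (εAt S ω O ε y').inv = (εAt S ω O ε y).inv ≫ (O.N ω).map g := by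
  rw [Iso.eq_inv_comp, ← Category.assoc, ← map_εAt_hom, Category.assoc, Iso.hom_inv_id, Category.comp_id]

/-- The functor of a composite path on morphisms, with plain objects. [cite: MochizukiAbsTopIII2015, Definition 3.5 (i) p.75] -/
theorem pathFunctor_comp_map {a b c : W} (p : Path a b) (q : Path b c) {x x' : S.obj a} (f : x ⟶ x') :
    (S.pathFunctor (p.comp q)).map f =
      eqToHom (by rw [pathFunctor_comp]; rfl) ≫ (S.pathFunctor q).map ((S.pathFunctor p).map f) ≫
        eqToHom (by rw [pathFunctor_comp]; rfl) :=
  Functor.congr_hom (S.pathFunctor_comp p q) f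

/-- `ε⁻¹` commutes with `eqToHom`. [cite: MochizukiAbsTopIII2015, Definition 3.5 (iv) p.76] -/
theorem εAt_inv_eqToHom {y y' : S.obj ω} (h : y = y') :
    (εAt S ω O ε y).inv ≫ eqToHom (by rw [h]) = eqToHom h ≫ (εAt S ω O ε y').inv := by
  subst h
  simp

/-- `𝒯_[γ] ⋙ N_b ≅ N_a` at an object, with plain objects. [folklore] -/
noncomputable def pathIsoAt {a b : W} (p : Path a b) (x : S.obj a) :
    (O.N b).obj ((S.pathFunctor p).obj x) ≅ (O.N a).obj x :=
  (O.pathIso p).app x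

/-- `pathIsoAt` along a composite path, at an object. [cite: MochizukiAbsTopIII2015, Definition 3.5 (iv) p.76] -/
theorem pathIsoAt_comp_hom {a b c : W} (r : Path a b) (p : Path b c) (x : S.obj a) :
    (pathIsoAt S ω O (r.comp p) x).hom =
      eqToHom (by rw [pathFunctor_comp]; rfl) ≫ (pathIsoAt S ω O p ((S.pathFunctor r).obj x)).hom ≫
        (pathIsoAt S ω O r x).hom :=
  O.pathIso_comp_hom_app' r p x

/-- Naturality of `pathIsoAt` in the object. [cite: MochizukiAbsTopIII2015, Definition 3.5 (iv) p.76] -/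
theorem map_pathIsoAt_hom {a b : W} (p : Path a b) {x x' : S.obj a} (f : x ⟶ x') :
    (O.N b).map ((S.pathFunctor p).map f) ≫ (pathIsoAt S ω O p x').hom = (pathIsoAt S ω O p x).hom ≫ (O.N a).map f :=
  (O.pathIso p).hom.naturality f

/-- The canonical isomorphism `φ_γ : 𝒯_[γ](x) ≅ N_a(x)` for a path `γ : a ⟶ v_𝒮`, through the structure functors
(`N_{v_𝒮} ≅ 𝟭` and `𝒯_[γ] ⋙ N_{v_𝒮} ≅ N_a`); the core homotopy of `DiagramCores.lean` is `φ_{γ₁} ∘ φ_{γ₂}⁻¹`.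
[cite: MochizukiAbsTopIII2015, Definition 3.5 (iii) p.75] -/
noncomputable def obsIsoAt {a : W} (p : Path a ω) (x : S.obj a) : (S.pathFunctor p).obj x ≅ (O.N a).obj x :=
  (εAt S ω O ε ((S.pathFunctor p).obj x)).symm ≪≫ pathIsoAt S ω O p x

/-- Naturality of `φ_γ` in the object. [cite: MochizukiAbsTopIII2015, Definition 3.5 (iv) p.76] -/
theorem map_obsIsoAt_hom {a : W} (p : Path a ω) {x x' : S.obj a} (f : x ⟶ x') :
    (S.pathFunctor p).map f ≫ (obsIsoAt S ω O ε p x').hom = (obsIsoAt S ω O ε p x).hom ≫ (O.N a).map f := by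
  simp only [obsIsoAt, Iso.trans_hom, Iso.symm_hom, Category.assoc]
  rw [← map_pathIsoAt_hom, ← Category.assoc, map_εAt_inv, Category.assoc]

/-- `φ_γ` as a natural isomorphism `𝒯_[γ] ≅ N_a`. [cite: MochizukiAbsTopIII2015, Definition 3.5 (iii) p.75] -/
noncomputable def obsIso {a : W} (p : Path a ω) : S.pathFunctor p ≅ O.N a :=
  NatIso.ofComponents (obsIsoAt S ω O ε p) (fun f => map_obsIsoAt_hom S ω O ε p f)

/-- `φ_γ` in whiskered form: `(𝒯_[γ] ◁ ε⁻¹) ∘ pathIso_γ` (note `𝒯_[γ] ⋙ 𝟭 = 𝒯_[γ]` definitionally).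
[cite: MochizukiAbsTopIII2015, Definition 3.5 (iii) p.75] -/
theorem obsIso_eq_whisker {a : W} (p : Path a ω) :
    obsIso S ω O ε p = Functor.isoWhiskerLeft (S.pathFunctor p) ε.symm ≪≫ O.pathIso p := by
  ext x
  simp only [obsIso, NatIso.ofComponents_hom_app, obsIsoAt, εAt, pathIsoAt, Iso.trans_hom, Iso.symm_hom,
    Iso.app_hom, Iso.app_inv, Functor.isoWhiskerLeft_hom, NatTrans.comp_app, Functor.whiskerLeft_app]
  rfl

/-- The **loop isomorphism** `σ_m(y) : 𝒯_[m](y) ≅ y` of a loop `m` at `v_𝒮`: `𝒯_[m] ≅ N_{v_𝒮} ≅ 𝟭` at `y`. [folklore] -/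
noncomputable def loopAt (m : Path ω ω) (y : S.obj ω) : (S.pathFunctor m).obj y ≅ y :=
  obsIsoAt S ω O ε m y ≪≫ εAt S ω O ε y

/-- Naturality of the loop isomorphism. [cite: MochizukiAbsTopIII2015, Definition 3.5 (iv) p.76] -/
theorem map_loopAt_hom (m : Path ω ω) {y y' : S.obj ω} (f : y ⟶ y') :
    (S.pathFunctor m).map f ≫ (loopAt S ω O ε m y').hom = (loopAt S ω O ε m y).hom ≫ f := by
  simp only [loopAt, Iso.trans_hom, ← Category.assoc, map_obsIsoAt_hom]
  simp only [Category.assoc, map_εAt_hom]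

/-- Conjugating a morphism by the loop isomorphism `σ_m` is applying `𝒯_[m]` (naturality of `σ_m`). [cite: MochizukiAbsTopIII2015, Definition 3.5 (iv) p.76] -/
theorem loopAt_conj (m : Path ω ω) {y y' : S.obj ω} (f : y ⟶ y') :
    (loopAt S ω O ε m y).hom ≫ f ≫ (loopAt S ω O ε m y').inv = (S.pathFunctor m).map f := by
  rw [← Category.assoc, ← map_loopAt_hom, Category.assoc, Iso.hom_inv_id, Category.comp_id]

/-- **Loop lemma**: `φ_{m ∘ γ}(x) = φ_γ(x) ∘ σ_m(𝒯_[γ] x)`. [cite: MochizukiAbsTopIII2015, Definition 3.5 (iv) p.76] -/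
theorem obsIsoAt_comp_loop {a : W} (p : Path a ω) (m : Path ω ω) (x : S.obj a) :
    obsIsoAt S ω O ε (p.comp m) x =
      eqToIso (by rw [pathFunctor_comp]; rfl) ≪≫ loopAt S ω O ε m ((S.pathFunctor p).obj x) ≪≫ obsIsoAt S ω O ε p x := by
  ext
  simp only [obsIsoAt, loopAt, Iso.trans_hom, Iso.symm_hom, eqToIso.hom, Category.assoc, Iso.hom_inv_id_assoc,
    pathIsoAt_comp_hom]
  rw [← Category.assoc, ← Category.assoc, εAt_inv_eqToHom S ω O ε
    (show (S.pathFunctor (p.comp m)).obj x = (S.pathFunctor m).obj ((S.pathFunctor p).obj x) by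
      rw [pathFunctor_comp]; rfl)]
  simp only [Category.assoc]

/-- **Loop lemma** (homotopy form): the core homotopy `φ_{m∘γ₁} ∘ φ_{m∘γ₂}⁻¹` of two paths prolonged by the same
loop `m` at `v_𝒮` is `𝒯_[m]` applied to the core homotopy `φ_{γ₁} ∘ φ_{γ₂}⁻¹` (up to `eqToHom`). [cite: MochizukiAbsTopIII2015, Definition 3.5 (iv) p.76] -/
theorem obsIsoAt_hom_inv_loop {a : W} (p q : Path a ω) (m : Path ω ω) (x : S.obj a) :
    (obsIsoAt S ω O ε (p.comp m) x).hom ≫ (obsIsoAt S ω O ε (q.comp m) x).inv =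
      eqToHom (by rw [pathFunctor_comp]; rfl) ≫
        (S.pathFunctor m).map ((obsIsoAt S ω O ε p x).hom ≫ (obsIsoAt S ω O ε q x).inv) ≫
        eqToHom (by rw [pathFunctor_comp]; rfl) := by
  rw [obsIsoAt_comp_loop, obsIsoAt_comp_loop, ← loopAt_conj S ω O ε m]
  simp only [Iso.trans_hom, Iso.trans_inv, eqToIso.hom, eqToIso.inv, Category.assoc]

/-- **Prefix lemma**: `φ_{γ ∘ r₁}(x) = pathIso_{r₁}(x) ∘ φ_γ(𝒯_[r₁] x)` for a path `r₁` PRE-composed. [cite: MochizukiAbsTopIII2015, Definition 3.5 (iv) p.76] -/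
theorem obsIsoAt_precomp {c a : W} (r₁ : Path c a) (p : Path a ω) (x : S.obj c) :
    obsIsoAt S ω O ε (r₁.comp p) x =
      eqToIso (by rw [pathFunctor_comp]; rfl) ≪≫ obsIsoAt S ω O ε p ((S.pathFunctor r₁).obj x) ≪≫
        pathIsoAt S ω O r₁ x := by
  ext
  simp only [obsIsoAt, Iso.trans_hom, Iso.symm_hom, eqToIso.hom, Category.assoc, pathIsoAt_comp_hom]
  rw [← Category.assoc, ← Category.assoc, εAt_inv_eqToHom S ω O ε
    (show (S.pathFunctor (r₁.comp p)).obj x = (S.pathFunctor p).obj ((S.pathFunctor r₁).obj x) by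
      rw [pathFunctor_comp]; rfl)]
  simp only [Category.assoc]

/-- Prefix lemma (homotopy form): the core homotopy of `γ₁ ∘ r₁, γ₂ ∘ r₁` at `x` is the core homotopy of `γ₁, γ₂` at
`𝒯_[r₁] x` (up to `eqToHom`). [cite: MochizukiAbsTopIII2015, Definition 3.5 (iv) p.76] -/
theorem obsIsoAt_hom_inv_precomp {c a : W} (r₁ : Path c a) (p q : Path a ω) (x : S.obj c) :
    (obsIsoAt S ω O ε (r₁.comp p) x).hom ≫ (obsIsoAt S ω O ε (r₁.comp q) x).inv =
      eqToHom (by rw [pathFunctor_comp]; rfl) ≫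
        ((obsIsoAt S ω O ε p ((S.pathFunctor r₁).obj x)).hom ≫
          (obsIsoAt S ω O ε q ((S.pathFunctor r₁).obj x)).inv) ≫
        eqToHom (by rw [pathFunctor_comp]; rfl) := by
  rw [obsIsoAt_precomp, obsIsoAt_precomp]
  simp only [Iso.trans_hom, Iso.trans_inv, eqToIso.hom, eqToIso.inv, Category.assoc, Iso.hom_inv_id_assoc]

end ObsIso

section TeleHom

variable {W : Type w} [Quiver.{v} W] (S : DiagramOfCategories.{v, u, w} W) (ω : W)
  (O : S.OverData (S.obj ω)) (ε : O.N ω ≅ 𝟭 (S.obj ω))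

/-- The homotopy `ζ_{([γ₃]∘[γ₁], [γ₃]∘[γ₂])} : 𝒯_[γ₃∘γ₁] ⟶ 𝒯_[γ₃∘γ₂]` of a telecore computed from a DECOMPOSITION of the
pair: the core homotopy `φ_{γ₁} ∘ φ_{γ₂}⁻¹ : 𝒯_[γ₁] ⟶ 𝒯_[γ₂]` whiskered with `𝒯_[γ₃]` (Def 3.5 (iv) (b)).
[cite: MochizukiAbsTopIII2015, Definition 3.5 (iv) p.76] -/
noncomputable def teleHomOfSplit {a b : W} {p q : Path a b} (p₁ q₁ : Path a ω) (r : Path ω b)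
    (hp : p = p₁.comp r) (hq : q = q₁.comp r) : S.pathFunctor p ⟶ S.pathFunctor q :=
  eqToHom (by rw [hp, pathFunctor_comp]) ≫
    Functor.whiskerRight ((obsIso S ω O ε p₁).hom ≫ (obsIso S ω O ε q₁).inv) (S.pathFunctor r) ≫
    eqToHom (by rw [hq, pathFunctor_comp])

/-- Components of `teleHomOfSplit`. [cite: MochizukiAbsTopIII2015, Definition 3.5 (iv) p.76] -/
theorem teleHomOfSplit_app {a b : W} {p q : Path a b} (p₁ q₁ : Path a ω) (r : Path ω b)
    (hp : p = p₁.comp r) (hq : q = q₁.comp r) (x : S.obj a) :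
    (teleHomOfSplit S ω O ε p₁ q₁ r hp hq).app x =
      eqToHom (by rw [hp, pathFunctor_comp]; rfl) ≫
        (S.pathFunctor r).map ((obsIsoAt S ω O ε p₁ x).hom ≫ (obsIsoAt S ω O ε q₁ x).inv) ≫
        eqToHom (by rw [hq, pathFunctor_comp]; rfl) := by
  simp only [teleHomOfSplit, obsIso, NatTrans.comp_app, eqToHom_app, Functor.whiskerRight_app,
    NatIso.ofComponents_hom_app, NatIso.ofComponents_inv_app]
  rfl

/-- **Independence of the decomposition, loop case**: prolonging `γ₁, γ₂` by a loop `m` at `v_𝒮` and shortening `γ₃`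
accordingly does not change the homotopy. [cite: MochizukiAbsTopIII2015, Definition 3.5 (iv) p.76] -/
theorem teleHomOfSplit_loop {a b : W} {p q : Path a b} (p₁ q₁ : Path a ω) (m : Path ω ω) (r : Path ω b)
    (hp : p = p₁.comp (m.comp r)) (hq : q = q₁.comp (m.comp r))
    (hp' : p = (p₁.comp m).comp r) (hq' : q = (q₁.comp m).comp r) :
    teleHomOfSplit S ω O ε p₁ q₁ (m.comp r) hp hq = teleHomOfSplit S ω O ε (p₁.comp m) (q₁.comp m) r hp' hq' := by
  ext x
  rw [teleHomOfSplit_app, teleHomOfSplit_app, obsIsoAt_hom_inv_loop, pathFunctor_comp_map]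
  simp only [Functor.map_comp, eqToHom_map, Category.assoc, eqToHom_trans, eqToHom_trans_assoc]

/-- `teleHomOfSplit` only depends on the decomposition data. [cite: MochizukiAbsTopIII2015, Definition 3.5 (iv) p.76] -/
theorem teleHomOfSplit_congr {a b : W} {p q : Path a b} {p₁ p₁' q₁ q₁' : Path a ω} {r r' : Path ω b}
    (h₁ : p₁ = p₁') (h₂ : q₁ = q₁') (h₃ : r = r') (hp : p = p₁.comp r) (hq : q = q₁.comp r)
    (hp' : p = p₁'.comp r') (hq' : q = q₁'.comp r') :
    teleHomOfSplit S ω O ε p₁ q₁ r hp hq = teleHomOfSplit S ω O ε p₁' q₁' r' hp' hq' := by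
  subst h₁ h₂ h₃
  rfl

/-- `teleHomOfSplit` of a pair with itself is the identity. [cite: MochizukiAbsTopIII2015, Definition 3.5 (iv) p.76] -/
theorem teleHomOfSplit_self {a b : W} {p : Path a b} (p₁ : Path a ω) (r : Path ω b) (hp : p = p₁.comp r) :
    teleHomOfSplit S ω O ε p₁ p₁ r hp hp = 𝟙 _ := by
  ext x
  rw [teleHomOfSplit_app]
  simp only [Iso.hom_inv_id, Functor.map_id, Category.id_comp, eqToHom_trans, eqToHom_refl, NatTrans.id_app]

/-- `teleHomOfSplit` is transitive along a common `γ₃`. [cite: MochizukiAbsTopIII2015, Definition 3.5 (iv) p.76] -/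
theorem teleHomOfSplit_trans {a b : W} {p q s : Path a b} (p₁ q₁ s₁ : Path a ω) (r : Path ω b)
    (hp : p = p₁.comp r) (hq : q = q₁.comp r) (hs : s = s₁.comp r) :
    teleHomOfSplit S ω O ε p₁ q₁ r hp hq ≫ teleHomOfSplit S ω O ε q₁ s₁ r hq hs =
      teleHomOfSplit S ω O ε p₁ s₁ r hp hs := by
  ext x
  simp only [NatTrans.comp_app, teleHomOfSplit_app, Category.assoc, eqToHom_trans_assoc, eqToHom_refl,
    Category.id_comp]
  rw [← Category.assoc ((S.pathFunctor r).map _), ← Functor.map_comp]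
  simp only [Category.assoc, Iso.inv_hom_id_assoc]

/-- **Whiskering**: the homotopy of the pair `(r₁;γ;r₂)`-extended on both sides, computed from the extended decomposition,
is the whiskered homotopy (Def 3.5 (ii), third axiom). [cite: MochizukiAbsTopIII2015, Definition 3.5 (iv) p.76] -/
theorem teleHomOfSplit_whisker {c a b d : W} {p q : Path a b} (p₁ q₁ : Path a ω) (r : Path ω b)
    (hp : p = p₁.comp r) (hq : q = q₁.comp r) (r₁ : Path c a) (r₂ : Path b d)
    (hp' : r₁.comp (p.comp r₂) = (r₁.comp p₁).comp (r.comp r₂))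
    (hq' : r₁.comp (q.comp r₂) = (r₁.comp q₁).comp (r.comp r₂)) :
    teleHomOfSplit S ω O ε (r₁.comp p₁) (r₁.comp q₁) (r.comp r₂) hp' hq' =
      eqToHom (by rw [pathFunctor_comp, pathFunctor_comp]) ≫
        Functor.whiskerLeft (S.pathFunctor r₁)
          (Functor.whiskerRight (teleHomOfSplit S ω O ε p₁ q₁ r hp hq) (S.pathFunctor r₂)) ≫
        eqToHom (by rw [pathFunctor_comp, pathFunctor_comp]) := by
  ext x
  rw [app_eqToHom_whisker, teleHomOfSplit_app, teleHomOfSplit_app, obsIsoAt_hom_inv_precomp,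
    pathFunctor_comp_map]
  simp only [Functor.map_comp, eqToHom_map, Category.assoc, eqToHom_trans, eqToHom_trans_assoc]

end TeleHom

/-! ## The telecore family of a telecore diagram with structure functors -/

section Family

variable {V : Type w} [Quiver.{v} V] (D : DiagramOfCategories.{v, u, w} V) (X : ExtShape.{v} V)
  (Y : D.ExtData X) (O : (D.extend Y).OverData ((D.extend Y).obj X.obs)) (ε : O.N X.obs ≅ 𝟭 _)

/-- The homotopy of a boundary pair, computed from the CANONICAL decompositions (last visit of `v_𝒮`).
[cite: MochizukiAbsTopIII2015, Definition 3.5 (iv) p.76] -/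
noncomputable def teleHom {a b : X.Vertex} {p q : Path a b} (h : X.TeleRel p q) :
    (D.extend Y).pathFunctor p ⟶ (D.extend Y).pathFunctor q :=
  teleHomOfSplit (D.extend Y) X.obs O ε (X.splitLeft h).1 (X.splitRight h).1 (X.splitLeft h).2
    (X.eq_comp_splitLeft h) (X.eq_comp_splitRight h)

/-- **Independence of the decomposition**: the homotopy of a boundary pair may be computed from ANY common
decomposition `([γ₃]∘[γ₁], [γ₃]∘[γ₂])` (reduction to the canonical one by the loop lemma). [cite: MochizukiAbsTopIII2015, Definition 3.5 (iv) p.76] -/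
theorem teleHom_eq_of_split {a b : X.Vertex} {p q : Path a b} (h : X.TeleRel p q) (p₁ q₁ : Path a X.obs)
    (r : Path X.obs b) (hp : p = p₁.comp r) (hq : q = q₁.comp r) :
    teleHom D X Y O ε h = teleHomOfSplit (D.extend Y) X.obs O ε p₁ q₁ r hp hq := by
  obtain ⟨⟨m, r₀⟩, hs⟩ := X.exists_lastSplit_of_source_obs r
  have hr : r = m.comp r₀ := X.eq_comp_of_lastSplit r hs
  have hsp : X.lastSplit p = some (p₁.comp m, r₀) := by rw [hp, X.lastSplit_comp, hs]; rfl
  have hsq : X.lastSplit q = some (q₁.comp m, r₀) := by rw [hq, X.lastSplit_comp, hs]; rfl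
  have e₁ : X.splitLeft h = (p₁.comp m, r₀) :=
    Option.some.inj ((X.lastSplit_eq_splitLeft h).symm.trans hsp)
  have e₂ : X.splitRight h = (q₁.comp m, r₀) :=
    Option.some.inj ((X.lastSplit_eq_splitRight h).symm.trans hsq)
  subst hr
  rw [teleHomOfSplit_loop (D.extend Y) X.obs O ε p₁ q₁ m r₀ hp hq
    (by rw [hp, Path.comp_assoc]) (by rw [hq, Path.comp_assoc])]
  exact teleHomOfSplit_congr (D.extend Y) X.obs O ε (congrArg Prod.fst e₁) (congrArg Prod.fst e₂)
    (congrArg Prod.snd e₁) _ _ _ _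

/-- **The telecore family `𝒥`** (Def 3.5 (iv) (b)) of a telecore diagram whose categories carry structure functors over
the core category: boundary set = the printed one (`TeleRel`), homotopies = core homotopies whiskered with the tail
(`teleHom`). [cite: MochizukiAbsTopIII2015, Definition 3.5 (iv) p.76] -/
noncomputable def teleFamily : (D.extend Y).HomotopyFamily where
  E := X.TeleRel
  isSaturated := X.teleRel_isSaturated
  η := fun _ _ _ _ h => teleHom D X Y O ε h
  η_refl := by
    intro a b p h
    rw [teleHom_eq_of_split D X Y O ε h (X.splitLeft h).1 (X.splitLeft h).1 (X.splitLeft h).2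
      (X.eq_comp_splitLeft h) (X.eq_comp_splitLeft h)]
    exact teleHomOfSplit_self _ _ _ _ _ _ _
  η_trans := by
    intro a b p q s h₁ h₂
    have e : (X.splitLeft h₁).2 = (X.splitLeft h₂).2 := by
      rw [X.splitLeft_snd h₁]; rfl
    have hs : s = (X.splitRight h₂).1.comp (X.splitLeft h₁).2 := by
      rw [e]; exact X.eq_comp_splitRight h₂
    rw [teleHom_eq_of_split D X Y O ε h₂ (X.splitRight h₁).1 (X.splitRight h₂).1 (X.splitLeft h₁).2
        (X.eq_comp_splitRight h₁) hs,
      teleHom_eq_of_split D X Y O ε (X.teleRel_isSaturated.trans h₁ h₂) (X.splitLeft h₁).1 (X.splitRight h₂).1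
        (X.splitLeft h₁).2 (X.eq_comp_splitLeft h₁) hs]
    exact (teleHomOfSplit_trans _ _ _ _ _ _ _ _ _ _ _).symm
  η_whisker := by
    intro a b c d p q h r₁ r₂
    rw [teleHom_eq_of_split D X Y O ε (X.teleRel_isSaturated.precomp (X.teleRel_isSaturated.postcomp h r₂) r₁)
        (r₁.comp (X.splitLeft h).1) (r₁.comp (X.splitRight h).1) ((X.splitLeft h).2.comp r₂)
        (by rw [Path.comp_assoc, ← Path.comp_assoc (X.splitLeft h).1, ← X.eq_comp_splitLeft h])
        (by rw [Path.comp_assoc, ← Path.comp_assoc (X.splitRight h).1, ← X.eq_comp_splitRight h])]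
    exact teleHomOfSplit_whisker _ _ _ _ _ _ _ _ _ _ _ _ _

/-- The boundary set of `𝒥` is the printed one. [cite: MochizukiAbsTopIII2015, Definition 3.5 (iv) p.76] -/
theorem teleFamily_E {a b : X.Vertex} (p q : Path a b) :
    (teleFamily D X Y O ε).E p q ↔ ∃ (p₁ q₁ : Path a X.obs) (r : Path X.obs b), p = p₁.comp r ∧ q = q₁.comp r :=
  Iff.rfl

/-- The homotopies of `𝒥` from any decomposition. [cite: MochizukiAbsTopIII2015, Definition 3.5 (iv) p.76] -/
theorem teleFamily_η {a b : X.Vertex} {p q : Path a b} (h : (teleFamily D X Y O ε).E p q) (p₁ q₁ : Path a X.obs)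
    (r : Path X.obs b) (hp : p = p₁.comp r) (hq : q = q₁.comp r) :
    (teleFamily D X Y O ε).η h = teleHomOfSplit (D.extend Y) X.obs O ε p₁ q₁ r hp hq :=
  teleHom_eq_of_split D X Y O ε h p₁ q₁ r hp hq

end Family

end DiagramOfCategories

end Literature.AnabelianGeometry.AbsoluteAnabelian
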